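import Summits.CriticalPhenomena.PercolationContinuityZ3.Theorems.PercNearOneGluingNoHeavyLowerTailMajorityGluingTypeTableStarCertificates
import HarnessLib

/-!
# The second-order bound `E ≤ ⅓u₁₂₃₄` of the abstract `(4,3)` programme when some relay is not very rich
(lane prim-rate, constants-miner 1, gen 28; CLEAN-CERTIFICATES.md §8 COROLLARY, CONVEX-BOOTSTRAP.md §3/§4 «OBJ world A», DERIVATIONS.md)

Support file for the closed crux `NoHeavyLowerTail` (stmt-CriticalPhenomena-4575), majority-gluing line; continuation of
`…MajorityGluingTypeTableStarCertificates`.  For a law `x ≥ 0` on the 94 types the STAR_w certificate in linear form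
reads `3E ≤ u₁₂₃₄ + Σ_{z≠w}(x(P_wz) − 2x(C_wz))`, and the three relay-root van den Berg–Kahn rows rooted at `v_w` in
reduced form read `(x(C_wz) + x(P_wz))·T_w ≤ x(C_wz)·(T_w + S_w)`, i.e. `x(P_wz)·T_w ≤ x(C_wz)·S_w`.  If relay `w`
is NOT VERY RICH, `S_w ≤ 2T_w` (richness `r_w = S_w/T_w − 1 ≤ 1`), then `x(P_wz) ≤ 2x(C_wz)` for each `z ≠ w` as soon
as `T_w > 0`, and every pair term of STAR_w is `≤ 0`:

  **`3·E(x) ≤ u₁₂₃₄(x)`** — the entry point of the world-A objective bound of THEOREM BOTTOM-2/3 (`E ≤ ⅓U₄ ≤ ⅓M^{κ₀}Π(S+T)^p`)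
  and of the COROLLARY of THEOREM BOTTOM («second-order form when some relay is not very rich»).

When `T_w = 0` the bound holds trivially by LEMMA B (`E ≤ T_w`, budgets), so the final statements `third_U4_w` need no
positivity hypothesis.  Real arithmetic over the law-level certificates; no definitions, no sorries.
[cite: VandenbergHaggstromKahn2005, Thm. 1.3 (p. 6)]
-/

namespace Summit.CriticalPhenomena.PercolationContinuityZ3.Theorems

namespace HubOnly
namespace TypeTable

noncomputable section
open DType

/-- The pair step without hub rows: `T > 0`, `C ≥ 0`, `S ≤ 2T` and the reduced relay-root row `(C + P)·T ≤ C·(T + S)`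
give `P − 2C ≤ 0`. -/
theorem pair_step_two {T S C P : ℝ} (hT : 0 < T) (hC : 0 ≤ C) (hrich : S ≤ 2 * T)
    (rel : (C + P) * T ≤ C * (T + S)) : P - 2 * C ≤ 0 := by
  have h1 : C * (T + S) ≤ C * (3 * T) := mul_le_mul_of_nonneg_left (by linarith) hC
  have h2 : (P - 2 * C) * T ≤ 0 := by nlinarith
  by_contra h
  push Not at h
  nlinarith [mul_pos h hT]

/-- The real-arithmetic core: STAR_w's linear form plus the three pair steps give `3E ≤ u₁₂₃₄`. -/
theorem third_real {Ex U T S C1 C2 C3 P1 P2 P3 : ℝ} (hT : 0 < T) (hC1 : 0 ≤ C1) (hC2 : 0 ≤ C2) (hC3 : 0 ≤ C3)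
    (hrich : S ≤ 2 * T) (star : 3 * Ex ≤ U + ((P1 - 2 * C1) + (P2 - 2 * C2) + (P3 - 2 * C3)))
    (rel1 : (C1 + P1) * T ≤ C1 * (T + S)) (rel2 : (C2 + P2) * T ≤ C2 * (T + S))
    (rel3 : (C3 + P3) * T ≤ C3 * (T + S)) : 3 * Ex ≤ U := by
  have h1 := pair_step_two hT hC1 hrich rel1
  have h2 := pair_step_two hT hC2 hrich rel2
  have h3 := pair_step_two hT hC3 hrich rel3
  linarith

/-- **`3E ≤ u₁₂₃₄` when relay 1 is not very rich** (`S₁ ≤ 2T₁`): rows `B₂, O_dn4_23, O_up4_23, O_dn3_24` (STAR₁) and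
the three relay-root rows rooted at `v₁` in reduced form; the case `T₁ = 0` by `E = T₁ − x(Q) ≤ T₁`. -/
theorem third_U4_1 (x : DType → ℝ) (hx : ∀ τ, 0 ≤ x τ) (hrich : Sm 1 x ≤ 2 * Tm 1 x)
    (r1 : lin (fun τ => τ.bud 2) x ≤ 0) (r2 : lin (fun τ => τ.odn 4 2 3) x ≤ 0)
    (r3 : lin (fun τ => τ.oup 4 2 3) x ≤ 0) (r4 : lin (fun τ => τ.odn 3 2 4) x ≤ 0)
    (rel2 : (Cm 1 2 x + Pm 1 2 x) * Tm 1 x ≤ Cm 1 2 x * (Tm 1 x + Sm 1 x))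
    (rel3 : (Cm 1 3 x + Pm 1 3 x) * Tm 1 x ≤ Cm 1 3 x * (Tm 1 x + Sm 1 x))
    (rel4 : (Cm 1 4 x + Pm 1 4 x) * Tm 1 x ≤ Cm 1 4 x * (Tm 1 x + Sm 1 x)) :
    3 * E x ≤ uS [1, 2, 3, 4] x := by
  rcases (lin_ind_nonneg (fun τ => τ.isT 1) hx).eq_or_lt with h0 | hpos
  · have hE : E x ≤ Tm 1 x := by
      have h := E_eq_T1_sub_Q x
      have hQ := lin_ind_nonneg (fun τ => τ.eZ == -1) hx
      linarith
    have hU := lin_ind_nonneg (fun τ => τ.uB [1, 2, 3, 4]) hx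
    have hT0 : Tm 1 x = 0 := by simp only [Tm]; exact h0.symm
    simp only [uS, DType.uZ] at hU ⊢
    linarith
  · exact third_real hpos (lin_ind_nonneg _ hx) (lin_ind_nonneg _ hx) (lin_ind_nonneg _ hx) hrich
      (star1 x hx r1 r2 r3 r4) rel2 rel3 rel4

/-- **`3E ≤ u₁₂₃₄` when relay 2 is not very rich** (`S₂ ≤ 2T₂`): rows `Cpair_34, CaloneY_3_2, CaloneY_4_2` (STAR₂), the
budget `B₂` (for the case `T₂ = 0`, LEMMA B) and the three relay-root rows rooted at `v₂`. -/
theorem third_U4_2 (x : DType → ℝ) (hx : ∀ τ, 0 ≤ x τ) (hrich : Sm 2 x ≤ 2 * Tm 2 x)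
    (hB : lin (fun τ => τ.bud 2) x ≤ 0)
    (r1 : lin (fun τ => τ.cpair 3 4) x ≤ 0) (r2 : lin (fun τ => τ.caloneY 3 2) x ≤ 0)
    (r3 : lin (fun τ => τ.caloneY 4 2) x ≤ 0)
    (rel1 : (Cm 2 1 x + Pm 2 1 x) * Tm 2 x ≤ Cm 2 1 x * (Tm 2 x + Sm 2 x))
    (rel3 : (Cm 2 3 x + Pm 2 3 x) * Tm 2 x ≤ Cm 2 3 x * (Tm 2 x + Sm 2 x))
    (rel4 : (Cm 2 4 x + Pm 2 4 x) * Tm 2 x ≤ Cm 2 4 x * (Tm 2 x + Sm 2 x)) :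
    3 * E x ≤ uS [1, 2, 3, 4] x := by
  rcases (lin_ind_nonneg (fun τ => τ.isT 2) hx).eq_or_lt with h0 | hpos
  · have hE : E x ≤ Tm 2 x := (E_le_T 2 (by simp) x hx hB).2
    have hU := lin_ind_nonneg (fun τ => τ.uB [1, 2, 3, 4]) hx
    have hT0 : Tm 2 x = 0 := by simp only [Tm]; exact h0.symm
    simp only [uS, DType.uZ] at hU ⊢
    linarith
  · exact third_real hpos (lin_ind_nonneg _ hx) (lin_ind_nonneg _ hx) (lin_ind_nonneg _ hx) hrich
      (star2 x hx r1 r2 r3) rel1 rel3 rel4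

/-- **`3E ≤ u₁₂₃₄` when relay 3 is not very rich** (`S₃ ≤ 2T₃`): rows `Cpair_24, CaloneY_2_3, CaloneY_4_3` (STAR₃), the
budget `B₃` and the three relay-root rows rooted at `v₃`. -/
theorem third_U4_3 (x : DType → ℝ) (hx : ∀ τ, 0 ≤ x τ) (hrich : Sm 3 x ≤ 2 * Tm 3 x)
    (hB : lin (fun τ => τ.bud 3) x ≤ 0)
    (r1 : lin (fun τ => τ.cpair 2 4) x ≤ 0) (r2 : lin (fun τ => τ.caloneY 2 3) x ≤ 0)
    (r3 : lin (fun τ => τ.caloneY 4 3) x ≤ 0)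
    (rel1 : (Cm 3 1 x + Pm 3 1 x) * Tm 3 x ≤ Cm 3 1 x * (Tm 3 x + Sm 3 x))
    (rel2 : (Cm 3 2 x + Pm 3 2 x) * Tm 3 x ≤ Cm 3 2 x * (Tm 3 x + Sm 3 x))
    (rel4 : (Cm 3 4 x + Pm 3 4 x) * Tm 3 x ≤ Cm 3 4 x * (Tm 3 x + Sm 3 x)) :
    3 * E x ≤ uS [1, 2, 3, 4] x := by
  rcases (lin_ind_nonneg (fun τ => τ.isT 3) hx).eq_or_lt with h0 | hpos
  · have hE : E x ≤ Tm 3 x := (E_le_T 3 (by simp) x hx hB).2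
    have hU := lin_ind_nonneg (fun τ => τ.uB [1, 2, 3, 4]) hx
    have hT0 : Tm 3 x = 0 := by simp only [Tm]; exact h0.symm
    simp only [uS, DType.uZ] at hU ⊢
    linarith
  · exact third_real hpos (lin_ind_nonneg _ hx) (lin_ind_nonneg _ hx) (lin_ind_nonneg _ hx) hrich
      (star3 x hx r1 r2 r3) rel1 rel2 rel4

/-- **`3E ≤ u₁₂₃₄` when relay 4 is not very rich** (`S₄ ≤ 2T₄`): rows `Cpair_23, CaloneY_2_4, CaloneY_3_4` (STAR₄), the
budget `B₄` and the three relay-root rows rooted at `v₄`. -/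
theorem third_U4_4 (x : DType → ℝ) (hx : ∀ τ, 0 ≤ x τ) (hrich : Sm 4 x ≤ 2 * Tm 4 x)
    (hB : lin (fun τ => τ.bud 4) x ≤ 0)
    (r1 : lin (fun τ => τ.cpair 2 3) x ≤ 0) (r2 : lin (fun τ => τ.caloneY 2 4) x ≤ 0)
    (r3 : lin (fun τ => τ.caloneY 3 4) x ≤ 0)
    (rel1 : (Cm 4 1 x + Pm 4 1 x) * Tm 4 x ≤ Cm 4 1 x * (Tm 4 x + Sm 4 x))
    (rel2 : (Cm 4 2 x + Pm 4 2 x) * Tm 4 x ≤ Cm 4 2 x * (Tm 4 x + Sm 4 x))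
    (rel3 : (Cm 4 3 x + Pm 4 3 x) * Tm 4 x ≤ Cm 4 3 x * (Tm 4 x + Sm 4 x)) :
    3 * E x ≤ uS [1, 2, 3, 4] x := by
  rcases (lin_ind_nonneg (fun τ => τ.isT 4) hx).eq_or_lt with h0 | hpos
  · have hE : E x ≤ Tm 4 x := (E_le_T 4 (by simp) x hx hB).2
    have hU := lin_ind_nonneg (fun τ => τ.uB [1, 2, 3, 4]) hx
    have hT0 : Tm 4 x = 0 := by simp only [Tm]; exact h0.symm
    simp only [uS, DType.uZ] at hU ⊢
    linarith
  · exact third_real hpos (lin_ind_nonneg _ hx) (lin_ind_nonneg _ hx) (lin_ind_nonneg _ hx) hrich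
      (star4 x hx r1 r2 r3) rel1 rel2 rel3

/-- **Second-order form, any relay.**  Under the budgets, STAR's thirteen linear rows and the twelve relay-root rows in
reduced form: if SOME relay `w` has `S_w ≤ 2T_w` (richness `r_w ≤ 1`) then `3E ≤ u₁₂₃₄`.  (With ISO₄ in profile form,
`u₁₂₃₄ ≤ (M^{4−c₄}Π_z(S_z+T_z))^{1/c₄}`, this is the «E ≤ ⅓U₄» branch of THEOREM BOTTOM-2/3's world A.) -/
theorem third_U4 (x : DType → ℝ) (hx : ∀ τ, 0 ≤ x τ)
    (hB2 : lin (fun τ => τ.bud 2) x ≤ 0) (hB3 : lin (fun τ => τ.bud 3) x ≤ 0)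
    (hB4 : lin (fun τ => τ.bud 4) x ≤ 0)
    (o1 : lin (fun τ => τ.odn 4 2 3) x ≤ 0) (o2 : lin (fun τ => τ.oup 4 2 3) x ≤ 0)
    (o3 : lin (fun τ => τ.odn 3 2 4) x ≤ 0)
    (c34 : lin (fun τ => τ.cpair 3 4) x ≤ 0) (y32 : lin (fun τ => τ.caloneY 3 2) x ≤ 0)
    (y42 : lin (fun τ => τ.caloneY 4 2) x ≤ 0)
    (c24 : lin (fun τ => τ.cpair 2 4) x ≤ 0) (y23 : lin (fun τ => τ.caloneY 2 3) x ≤ 0)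
    (y43 : lin (fun τ => τ.caloneY 4 3) x ≤ 0)
    (c23 : lin (fun τ => τ.cpair 2 3) x ≤ 0) (y24 : lin (fun τ => τ.caloneY 2 4) x ≤ 0)
    (y34 : lin (fun τ => τ.caloneY 3 4) x ≤ 0)
    (rel : ∀ r ∈ [1, 2, 3, 4], ∀ z ∈ [1, 2, 3, 4], r ≠ z →
      (Cm r z x + Pm r z x) * Tm r x ≤ Cm r z x * (Tm r x + Sm r x))
    (hw : ∃ w ∈ [1, 2, 3, 4], Sm w x ≤ 2 * Tm w x) : 3 * E x ≤ uS [1, 2, 3, 4] x := by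
  obtain ⟨w, hwm, hrich⟩ := hw
  simp only [List.mem_cons, List.not_mem_nil, or_false] at hwm
  rcases hwm with rfl | rfl | rfl | rfl
  · exact third_U4_1 x hx hrich hB2 o1 o2 o3 (rel 1 (by simp) 2 (by simp) (by norm_num))
      (rel 1 (by simp) 3 (by simp) (by norm_num)) (rel 1 (by simp) 4 (by simp) (by norm_num))
  · exact third_U4_2 x hx hrich hB2 c34 y32 y42 (rel 2 (by simp) 1 (by simp) (by norm_num))
      (rel 2 (by simp) 3 (by simp) (by norm_num)) (rel 2 (by simp) 4 (by simp) (by norm_num))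
  · exact third_U4_3 x hx hrich hB3 c24 y23 y43 (rel 3 (by simp) 1 (by simp) (by norm_num))
      (rel 3 (by simp) 2 (by simp) (by norm_num)) (rel 3 (by simp) 4 (by simp) (by norm_num))
  · exact third_U4_4 x hx hrich hB4 c23 y24 y34 (rel 4 (by simp) 1 (by simp) (by norm_num))
      (rel 4 (by simp) 2 (by simp) (by norm_num)) (rel 4 (by simp) 3 (by simp) (by norm_num))

end

end TypeTable
end HubOnly

end Summit.CriticalPhenomena.PercolationContinuityZ3.Theorems
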